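import Summits.CriticalPhenomena.Ising3DConformalLimit.Theses.TauBallRounding
import Literature.Probability.LatticeModels.DirInvCorrLength

/-!
# Birth skeleton (BC3) for crux `MonotoneRounding` — item stmt-CriticalPhenomena-4807

Route `TauBallRounding` (route-CriticalPhenomena-TauBallRounding), crux rank 2 (T1), concluded BY NAME:
`Summit.CriticalPhenomena.Ising3DConformalLimit.Theses.TauBallRounding.MonotoneRounding` — for every
directional-rate function `τ` of the subcritical plus-state two-point function on `ℤ³`
(`-n⁻¹ log ⟨σ₀σ_{nx}⟩⁺_β → τ β x`, `0 < β < β_c(3)`) and every `x ≠ 0`, the anisotropy ratio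
`β ↦ τ β x / τ β e₁` is antitone on `(0, β_c(3))` (signature fixed by the route, never restated here).

## The line: the route header's own TWO-LAYER PLAN for this node, typed as two named stubs

  (T1)  ⇐  [S1  β ↦ ξ_β(x) := dirInvCorrLength 3 β x is differentiable on (0, β_c(3))]      — regularity
         + [S2  the STRING INEQUALITY  ∂_β log ξ_β(x) ≤ ∂_β log ξ_β(e₁)  (0 < β < β_c(3), x ≠ 0)] — the core

Any rate function `τ` of the crux coincides with `dirInvCorrLength 3` on `(0, β_c(3)) × ℤ³`
(`tendsto_dirInvCorrLength` + uniqueness of limits), so both stubs are stated over the existing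
Literature declaration `Literature.Probability.LatticeModels.dirInvCorrLength` (CIV 2003 §1.1 (1.1)).

* `stub_rateDifferentiable` (S1; expected, M–L): for every `x ∈ ℤ³`, `β ↦ ξ_β(x)` is differentiable
  on the open interval `(0, β_c(3))`. In print: analyticity of the mass gap / inverse correlation
  length at SMALL `β` (Paes-Leme 1978; Bricmont–Fröhlich 1985, one-particle analysis of the transfer
  matrix; cluster expansion), local analyticity of the `ξ_β`-unit sphere in the DIRECTION for all
  `β < β_c` (CampaninoIoffeVelenik2003 Thm 2); differentiability in `β` on the whole of `(0, β_c)` is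
  the companion regularity statement (no phase transition below `β_c`; sharpness ABF 1987). The
  intended tool is the fluctuation-sum formula `∂_β log⟨σ₀σ_y⟩_{Λ,β} = Σ_b ⟨σ₀σ_y ; σ_b⟩_{Λ,β}`
  with exponential clustering below `β_c` to exchange `Λ ↑ ℤ³`, `n → ∞` and `∂_β`.
* `stub_stringInequality` (S2; OPEN — the hardest stub, the conjecture's core): for `x ≠ 0` and
  `0 < β < β_c(3)`, whenever `D_x`, `D₁` are the `β`-derivatives of `log ξ_β(x)` and `log ξ_β(e₁)`
  at `β`, then `D_x ≤ D₁` (both are `≤ 0` by GKS, `dirInvCorrLength_antitoneOn`: the oblique string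
  loses mass at least as fast, in relative terms, as the axis string). Guarded by `HasDerivAt`, so no
  `deriv` junk value enters; S1 discharges the guards. Supported by `β → 0⁺` asymptotics
  (`ξ_β(x) = ‖x‖₁ log coth β − (geodesic entropy) + o(1)`, ratio `↓` from `‖x‖₁`), by the MMS window
  `‖x‖_∞ ≤ ξ_β(x)/ξ_β(e₁) ≤ ‖x‖₁` (`supNorm_mul_dirInvCorrLength_axis_le`,
  `dirInvCorrLength_le_l1Norm_mul_axis`: the ratio STARTS at its maximal admissible value), and by the
  solvable square lattice (item PlanarExactRounding, proved). Why it might fail: no correlation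
  inequality comparing the string energies `Σ_b⟨σ₀σ_{nx};σ_b⟩/⟨σ₀σ_{nx}⟩` of different strings is known
  (route header, why-it-might-fail of r2).

`MonotoneRounding_of` takes EXACTLY the two stub statements (name-keyed aliases `Registered.stub_*`) as hypotheses
and concludes the crux BY NAME.
The composition is a genuine (not one-line) argument: identify `τ` with `ξ` on the domain (uniqueness of
limits), positivity of `ξ_β(x)` for `x ≠ 0` below `β_c` (`dirInvCorrLength_pos`, ABF sharpness), the
log-ratio `F = log ξ(x) − log ξ(e₁)` has derivative `D_x − D₁ ≤ 0` on the open convex interval (S1 + S2),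
hence is antitone by the mean value theorem (`antitoneOn_of_deriv_nonpos`), and `ratio = exp ∘ F` there.
The only `sorry`s of the file sit inside the two `stub_*`.

Disproof / negatives: no `Disproof.lean` exists for this crux (`ledger crux ls stmt-CriticalPhenomena-4807`:
no workfiles, 2026-08-17); `ledger negatives --problem CriticalPhenomena` (11 entries) has nothing in this
sub-problem and nothing about correlation lengths, their `β`-dependence or anisotropy.
Skeleton registrar: planner-skel-stmt-CriticalPhenomena-4807-0 (2026-08-17).
-/

namespace Summit.CriticalPhenomena.Ising3DConformalLimit.Cruxes.MonotoneRounding.Birth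

open Literature.Probability.LatticeModels
open Summit.CriticalPhenomena.Ising3DConformalLimit.Theses.TauBallRounding (MonotoneRounding)

/-! ## Registered stubs (two statements, each spelled out; `MonotoneRounding_of` takes exactly these) -/

/-- **S1 — differentiability of the directional inverse correlation length in `β` below `β_c`**
(expected; M–L): for every lattice direction `x ∈ ℤ³`, `β ↦ ξ_β(x) = dirInvCorrLength 3 β x` is
differentiable on `(0, β_c(3))`. [Paesleme1978; BricmontFrohlich1985; CampaninoIoffeVelenik2003 Thm 2
(analyticity in the direction); AizenmanBarskyFernandezJSP1987 (sharpness: no transition below β_c)] -/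
theorem stub_rateDifferentiable :
    ∀ x : Site 3, DifferentiableOn ℝ (fun β : ℝ => dirInvCorrLength 3 β x)
      (Set.Ioo 0 (criticalBeta 3)) := by
  sorry

/-- **S2 — the string inequality** (OPEN; the hardest stub, the core of T1): for `x ≠ 0` and
`0 < β < β_c(3)`, if `D_x` and `D₁` are the `β`-derivatives at `β` of `log ξ_β(x)` and of
`log ξ_β(e₁)`, then `D_x ≤ D₁` — in relative terms the oblique string loses mass at least as fast as
the axis string. (Guarded by `HasDerivAt`: no junk `deriv` enters; vacuous where a derivative fails to
exist, which S1 excludes.) [CampaninoIoffeVelenik2003; MessagerMiracleSoleJSP1977; CampostriniEtAl1998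
§4.7–4.8; Holzer1990; ZiaAvron1982] -/
theorem stub_stringInequality :
    ∀ x : Site 3, x ≠ 0 → ∀ β ∈ Set.Ioo 0 (criticalBeta 3), ∀ Dx D₁ : ℝ,
      HasDerivAt (fun b : ℝ => Real.log (dirInvCorrLength 3 b x)) Dx β →
      HasDerivAt (fun b : ℝ => Real.log (dirInvCorrLength 3 b (Pi.single 0 1))) D₁ β →
      Dx ≤ D₁ := by
  sorry

/-! ## Name-keyed aliases of the two stub statements (the hypotheses of the composition)

The skeleton audit (`#h21_check_skeleton`) admits a hypothesis of the composition only if its head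
constant is keyed by a registered stub name; these `abbrev`s are character-identical copies of the two
stub signatures above (`MonotoneRounding_of_stubs` below type-checks only if they agree). -/
namespace Registered

/-- Alias of the statement of `stub_rateDifferentiable` (S1), keyed by the registered stub name. -/
abbrev stub_rateDifferentiable : Prop :=
  ∀ x : Site 3, DifferentiableOn ℝ (fun β : ℝ => dirInvCorrLength 3 β x)
    (Set.Ioo 0 (criticalBeta 3))

/-- Alias of the statement of `stub_stringInequality` (S2), keyed by the registered stub name. -/
abbrev stub_stringInequality : Prop :=
  ∀ x : Site 3, x ≠ 0 → ∀ β ∈ Set.Ioo 0 (criticalBeta 3), ∀ Dx D₁ : ℝ,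
    HasDerivAt (fun b : ℝ => Real.log (dirInvCorrLength 3 b x)) Dx β →
    HasDerivAt (fun b : ℝ => Real.log (dirInvCorrLength 3 b (Pi.single 0 1))) D₁ β →
    Dx ≤ D₁

end Registered

/-! ## Composition (sorry-free): the two stub STATEMENTS imply the crux, by name -/


/-- **COMPOSITION.** S1 → S2 → `MonotoneRounding` (the TauBallRounding decl of item
stmt-CriticalPhenomena-4807); hypotheses = exactly the two registered stubs, by name. Identify the rate `τ` with `dirInvCorrLength 3` on
`(0, β_c(3)) × ℤ³` (uniqueness of limits), use positivity below `β_c` (ABF sharpness), differentiate the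
log-ratio (S1), bound its derivative by `0` (S2), apply the mean value theorem on the open convex
interval, and exponentiate. -/
theorem MonotoneRounding_of (hdiff : Registered.stub_rateDifferentiable)
    (hstring : Registered.stub_stringInequality) : MonotoneRounding := by
  dsimp only [Registered.stub_rateDifferentiable, Registered.stub_stringInequality] at hdiff hstring
  intro τ hτ x hx
  -- the axis direction is a nonzero site
  have he₁ : (Pi.single 0 1 : Site 3) ≠ 0 := by
    intro h
    have h0 := congrFun h 0
    simp at h0
  -- (1) the rate `τ` IS the directional inverse correlation length on `(0, β_c) × ℤ³`
  have hagree : ∀ β ∈ Set.Ioo 0 (criticalBeta 3), ∀ y : Site 3,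
      τ β y = dirInvCorrLength 3 β y := fun β hβ y =>
    tendsto_nhds_unique (hτ β y hβ.1 hβ.2) (tendsto_dirInvCorrLength hβ.1 y)
  -- (2) positivity below `β_c` (Aizenman–Barsky–Fernández sharpness)
  have hpos : ∀ β ∈ Set.Ioo 0 (criticalBeta 3), ∀ y : Site 3, y ≠ 0 →
      0 < dirInvCorrLength 3 β y := fun β hβ y hy =>
    dirInvCorrLength_pos (d := 3) (by norm_num) hβ.1 hβ.2 hy
  -- (3) the logarithms are differentiable on the domain (S1 + positivity)
  have hlog : ∀ y : Site 3, y ≠ 0 → ∀ β ∈ Set.Ioo 0 (criticalBeta 3),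
      HasDerivAt (fun b : ℝ => Real.log (dirInvCorrLength 3 b y))
        (deriv (fun b : ℝ => Real.log (dirInvCorrLength 3 b y)) β) β := by
    intro y hy β hβ
    have hd : DifferentiableAt ℝ (fun b : ℝ => dirInvCorrLength 3 b y) β :=
      (hdiff y).differentiableAt (Ioo_mem_nhds hβ.1 hβ.2)
    exact (hd.log (hpos β hβ y hy).ne').hasDerivAt
  -- (4) the log-ratio `F` has derivative `D_x − D₁ ≤ 0` (S2), hence is antitone (mean value theorem)
  set F : ℝ → ℝ := fun b =>
    Real.log (dirInvCorrLength 3 b x) - Real.log (dirInvCorrLength 3 b (Pi.single 0 1)) with hF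
  have hFderiv : ∀ β ∈ Set.Ioo 0 (criticalBeta 3), HasDerivAt F
      (deriv (fun b : ℝ => Real.log (dirInvCorrLength 3 b x)) β -
        deriv (fun b : ℝ => Real.log (dirInvCorrLength 3 b (Pi.single 0 1))) β) β :=
    fun β hβ => (hlog x hx β hβ).sub (hlog (Pi.single 0 1) he₁ β hβ)
  have hFanti : AntitoneOn F (Set.Ioo 0 (criticalBeta 3)) := by
    refine antitoneOn_of_deriv_nonpos (convex_Ioo 0 (criticalBeta 3)) ?_ ?_ ?_
    · exact fun β hβ => (hFderiv β hβ).continuousAt.continuousWithinAt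
    · rw [interior_Ioo]
      exact fun β hβ => (hFderiv β hβ).differentiableAt.differentiableWithinAt
    · rw [interior_Ioo]
      intro β hβ
      rw [(hFderiv β hβ).deriv]
      have hle := hstring x hx β hβ _ _ (hlog x hx β hβ) (hlog (Pi.single 0 1) he₁ β hβ)
      linarith
  -- (5) on the domain the ratio is `exp ∘ F`; conclude by monotonicity of `exp`
  have hratio : ∀ β ∈ Set.Ioo 0 (criticalBeta 3),
      τ β x / τ β (Pi.single 0 1) = Real.exp (F β) := by
    intro β hβ
    rw [hagree β hβ x, hagree β hβ (Pi.single 0 1), hF]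
    simp only [Real.exp_sub, Real.exp_log (hpos β hβ x hx),
      Real.exp_log (hpos β hβ (Pi.single 0 1) he₁)]
  intro a ha b hb hab
  show τ b x / τ b (Pi.single 0 1) ≤ τ a x / τ a (Pi.single 0 1)
  rw [hratio a ha, hratio b hb]
  exact Real.exp_le_exp.2 (hFanti ha hb hab)

/-- The crux from the two registered stubs (shows the stubs have exactly the hypothesis types; its
only `sorry`s are the stubs'). -/
theorem MonotoneRounding_of_stubs : MonotoneRounding :=
  MonotoneRounding_of stub_rateDifferentiable stub_stringInequality

end Summit.CriticalPhenomena.Ising3DConformalLimit.Cruxes.MonotoneRounding.Birth
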